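import Summits.ABC.ABC.Theses.RibetTakahashiSplit
import Summits.ABC.ABC.Theorems.RibetTakahashiSplitManyPrimeValuationProductFreyClassSuffices
import HarnessLib

/-!
# Crux `FewPrimeValuationProduct` (stmt-ABC-1563): the route consumes only its four-prime Frey part

Support file (`--supports stmt-ABC-1563`, registered sub-goal `exponentProductBound_of_manyPrimeFrey_of_freyFour`, formerly
`abcValuationProduct_of_manyPrimeFrey_of_freyFour`). The ONLY consumer of the few-prime crux r4 beyond the deciding
chain (where r3′ alone gives `ABC`, `abc_of_manyPrimeFreyClass`) is the milestone `AbcValuationProduct`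
(stmt-ABC-1567, `∏_{p ∣ abc} v_p(abc) ≤ K_ε rad^ε` for all abc triples). This file proves that the milestone needs
from r4 only its FREY PART ON FOUR-PRIME TRIPLES (`FreyFour`: the same bound for triples with `≤ 4` prime factors),
equivalently (`freyFewPrime_of_subexpFour`, landed) only SUB-EXPONENTIAL abc ON FOUR-PRIME TRIPLES (`SubexpFour`):

* `exponentProductBound_of_manyPrimeFrey_of_freyFour : ManyPrimeValuationProductFrey → FreyFour → AbcValuationProduct`
  (the `SubexpFour` form follows by composing with `freyFewPrime_of_subexpFour`); formerly
  `abcValuationProduct_of_manyPrimeFrey_of_freyFour` (deprecated alias, kept).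

Maintenance record (full-build repair, 2026-08-16): the gate's items-cap LINT AUTOFIX of 2026-08-16T14:16:23Z
dropped the milestone decl `AbcValuationProduct` (stmt-ABC-1567) from the gate-written route file, after which the
theorem (whose conclusion was that decl name) no longer elaborated; its conclusion is now the dropped decl's body,
written out verbatim, under the new name (theorems are append-only), with the old name a deprecated alias.

Hence a re-cut `r4 ↦ r4F := SubexpFour` (as r2 was re-cut to r2F at rev 6) loses nothing for the route, and drops the
non-Frey residual of r4 (curves of the class without a numerical Frey shadow), which no item consumes.
Proof: for a triple with `≤ 4` prime factors use `FreyFour` directly (no curve); with `≥ 5`, the Frey curve `W` of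
`FreyClassSuffices.exists_freyCurve_model` has `≥ 4` odd multiplicative primes (`(abc).primeFactors.erase 2 ⊆` the odd
multiplicative primes of `W`), so r2F gives `T(W) ≤ C N^ε ≤ C (2^10 rad)^ε` and `∏ v_p(abc) ≤ 4 T(W)`.
-/

-- `Summit.<Summit>.<Problem>`: for the single-conjunct summit `ABC` the duplicate `ABC.ABC` is mandated.
set_option linter.dupNamespace false

noncomputable section

namespace Summit.ABC.ABC.Theorems.FewPrimeValuationProduct

open scoped BigOperators
open Finset
open Literature.NumberTheory.DiophantineGeometry
open Summit.ABC.ABC.Theses.RibetTakahashiSplit (ManyPrimeValuationProductFrey)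

/-- **The milestone `AbcValuationProduct` from r2F and the four-prime Frey part of r4** (registered sub-goal).
For an abc triple with `≤ 4` prime factors the second hypothesis is the claim; with `≥ 5` prime factors the Frey
curve of the triple (`FreyClassSuffices.exists_freyCurve_model`) is in the Frey class, semistable away from `2`,
with `≥ 4` odd multiplicative primes, and `∏ v_p(abc) ≤ 4 T(W) ≤ 4 C (2^10 rad)^ε` by r2F.
The conclusion is the statement of the former route milestone decl
`Summit.ABC.ABC.Theses.RibetTakahashiSplit.AbcValuationProduct` (stmt-ABC-1567, dropped from the
gate-written route file by the items-cap LINT AUTOFIX of 2026-08-16T14:16:23Z), written out verbatim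
(full-build repair 2026-08-16: the decl name no longer resolves; same proposition, same proof); this
theorem replaces `abcValuationProduct_of_manyPrimeFrey_of_freyFour` (same content, whose conclusion was
that decl name), which survives as a deprecated alias.
[cite: BombieriGubler2006, Ex. 12.5.10] -/
theorem exponentProductBound_of_manyPrimeFrey_of_freyFour :
    Summit.ABC.ABC.Theses.RibetTakahashiSplit.ManyPrimeValuationProductFrey →
    (∀ ε : ℝ, 0 < ε → ∃ K : ℝ, ∀ a b c : ℕ, Literature.NumberTheory.DiophantineGeometry.IsABCTriple a b c →
      (a * b * c).primeFactors.card ≤ 4 →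
      ((∏ p ∈ (a * b * c).primeFactors, (a * b * c).factorization p : ℕ) : ℝ) ≤
        K * (Literature.NumberTheory.DiophantineGeometry.rad a b c : ℝ) ^ ε) →
    ∀ ε : ℝ, 0 < ε → ∃ K : ℝ, ∀ a b c : ℕ,
      Literature.NumberTheory.DiophantineGeometry.IsABCTriple a b c →
      ((∏ p ∈ (a * b * c).primeFactors, (a * b * c).factorization p : ℕ) : ℝ) ≤
        K * ((Literature.NumberTheory.DiophantineGeometry.rad a b c : ℕ) : ℝ) ^ ε := by
  intro hF h4 ε hε
  obtain ⟨C₂, hC₂⟩ := hF ε hε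
  obtain ⟨K₄, hK₄⟩ := h4 ε hε
  set C : ℝ := max C₂ 0 with hCdef
  have hC0 : 0 ≤ C := le_max_right _ _
  refine ⟨max (4 * C * ((2 : ℝ) ^ 10) ^ ε) K₄, fun a b c h => ?_⟩
  have hR0 : 0 < ((rad a b c : ℕ) : ℝ) := by
    rw [rad_def]; exact_mod_cast Nat.radical_pos _
  have hRε : 0 ≤ ((rad a b c : ℕ) : ℝ) ^ ε := Real.rpow_nonneg hR0.le ε
  rcases le_or_gt (a * b * c).primeFactors.card 4 with hle4 | hgt4
  · -- four-prime triples: the Frey part of r4 directly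
    exact (hK₄ a b c h hle4).trans (mul_le_mul_of_nonneg_right (le_max_right _ _) hRε)
  · -- at least five prime factors: the Frey curve has ≥ 4 odd multiplicative primes, use r2F
    obtain ⟨W, hE, hss, hfrey, hN, hsub, hprod⟩ := FreyClassSuffices.exists_freyCurve_model h
    haveI := hE
    have h2 : ((a * b * c).primeFactors.erase 2).card ≥ 4 := by
      have := Finset.pred_card_le_card_erase (s := (a * b * c).primeFactors) (a := 2)
      omega
    have hcard : 4 ≤ ((W.conductorNorm ℤ).primeFactors.filter
        (fun p => p ≠ 2 ∧ ¬ p ^ 2 ∣ W.conductorNorm ℤ)).card :=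
      le_trans h2 (Finset.card_le_card hsub)
    have hT : (multiplicativeValuationProduct W : ℝ) ≤ C * (W.conductorNorm ℤ : ℝ) ^ ε := by
      have hNε : 0 ≤ (W.conductorNorm ℤ : ℝ) ^ ε := by positivity
      exact (hC₂ W hss hfrey hcard).trans (mul_le_mul_of_nonneg_right (le_max_left _ _) hNε)
    set N : ℝ := ((W.conductorNorm ℤ : ℕ) : ℝ) with hNdef
    set R : ℝ := ((rad a b c : ℕ) : ℝ) with hRdef
    have hNR : N ≤ 2 ^ 10 * R := by
      have := Nat.le_of_dvd (mul_pos (by positivity) (by rw [rad_def]; exact Nat.radical_pos _)) hN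
      rw [hNdef, hRdef]; exact_mod_cast this
    calc ((∏ p ∈ (a * b * c).primeFactors, (a * b * c).factorization p : ℕ) : ℝ)
        ≤ ((4 * multiplicativeValuationProduct W : ℕ) : ℝ) := by exact_mod_cast hprod
      _ = 4 * (multiplicativeValuationProduct W : ℝ) := by push_cast; ring
      _ ≤ 4 * (C * N ^ ε) := by gcongr
      _ ≤ 4 * (C * (2 ^ 10 * R) ^ ε) := by gcongr
      _ = 4 * C * ((2 : ℝ) ^ 10) ^ ε * R ^ ε := by
          rw [Real.mul_rpow (by positivity) hR0.le]; ring
      _ ≤ max (4 * C * ((2 : ℝ) ^ 10) ^ ε) K₄ * R ^ ε :=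
          mul_le_mul_of_nonneg_right (le_max_left _ _) hRε

/-- Deprecated name of `exponentProductBound_of_manyPrimeFrey_of_freyFour` (it was stated against the
route decl `Summit.ABC.ABC.Theses.RibetTakahashiSplit.AbcValuationProduct`, dropped from the route file
2026-08-16; it remains the registered sub-goal name in the ledger's `supports` record of stmt-ABC-1563).
[folklore] -/
@[deprecated exponentProductBound_of_manyPrimeFrey_of_freyFour (since := "2026-08-16")]
alias abcValuationProduct_of_manyPrimeFrey_of_freyFour :=
  exponentProductBound_of_manyPrimeFrey_of_freyFour

end Summit.ABC.ABC.Theorems.FewPrimeValuationProduct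

end
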